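import Mathlib
import Summits.SmoothPoincare4.SmoothPoincare4.Theorems.SoloInformedAnchorIdentities

/-!
# Door D7 (the vanishing-disc door) — algebraic certificate (solo-informed, session s45)

Setting as in `SoloInformedAnchorIdentities`: `G` any group, `a b z : G` with `r0 : a³ = z`, `r1 : abab = z`
(`r2 : b⁷ = z` where needed); `z` is then central.  This models `Γ̃ = π₁Σ(2,3,7) = ⟨a, b ∣ a³ = (ab)² = b⁷⟩`
with `z = h` the fibre class; the mapping class group of the page `Y° = Σ(2,3,7)°` is `(Γ̃/⟨h²⟩) ⋊ ⟨ι⟩`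
and `X(φ) = (Y° ×_φ S¹) ∪ (S² × D²)` is the HKM book (arXiv:2402.11706): `X(a) = X(b) = S⁴`,
`{X(η), X(η h)} = {𝔐₀, S⁴}` with `η = b⁻³ab⁻¹ab⁻³a` (HKM24 Cor. 3.6, Question 1.4: is `𝔐₀ ≅ S⁴`?).

DOOR D7 (notebook `work/s45/fishtail-door.md`).  By Gompf's vanishing-disc lemma (arXiv:0908.1914, Lemma 2.2) and the
Stallings dictionary of the solo-informed door programme (`X(φ·P_g) =` the multiplicity-one logarithmic transform of
`X(φ)` along the page torus `T_g` in the direction `λ_Seif(g) + μ`), ONE smoothly embedded disc `Δ ⊂ S⁴ ∖ N(T₇)` with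
boundary `{pt} × (λ_Seif + μ) ⊂ ∂N(T₇)` and normal framing = torus framing `± 1`, where
`T₇ = τ³T(2,7) + h(δ₇) ⊂ S⁴ = X(a)` is the page torus of the class `g₄ = b³a⁻¹b⁻²`, gives
`X(a · g₄^j) ≅ X(a) = S⁴` for EVERY `j ∈ ℤ`.  The theorems below are the exact group-theoretic bookkeeping that turns
this into `𝔐₀ ≅ S⁴`:

* `SoloInformed_ba_ainv`        : `b a⁻¹ = a⁻¹ b⁻¹ a` (so the anchor `η = (b⁻²ab²)(ba⁻¹)³` reads `η = b⁻²ab² · a⁻¹b⁻³a`);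
* `SoloInformed_g4_braidConj`   : `g₄ = (b²a⁻¹) b⁻¹ (b²a⁻¹)⁻¹` exactly — `g₄` is a conjugate of `b⁻¹` (a rebased `e₇`, the lift of the braid axis of `T(2,7)`);
* `SoloInformed_g4_pow7`        : `g₄⁷ = z⁻¹` exactly (the `T₇`-family `a·g₄^j` has period 14 in the mapping class group);
* `SoloInformed_doorDelta_conj` : `b² η b⁻² = a · g₄³` (conjugating the anchor identity (δ) `η(ab⁻¹)³ = b⁻²ab²`);
* `SoloInformed_fishtailDoor_bookkeeping` : for ANY conjugation-invariant function `X` on `G` (e.g. the diffeomorphism type of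
  the book `X(φ)`), `(∀ j : ℤ, X(a·g₄^j) = X(a)) → X(η) = X(a) ∧ X(z·η) = X(a)` — i.e. one vanishing disc for `T₇` on
  `λ_Seif + μ` makes BOTH members of `{𝔐₀, S⁴} = {X(η), X(ηh)}` diffeomorphic to `X(a) = S⁴` (the two members are
  `j = 3` and `j = −4`), together with the sibling homotopy spheres `X(a g₄)`, `X(a g₄²)`.

No topology is formalised here: the file certifies the identities in every group satisfying the relations; the
topological input (Gompf's lemma, the Stallings-twist dictionary, push = `P_g`, `P_h = τ_∂`) is recorded with sources in
the notebook and in `CLAIMS.jsonl` (C582–C588).  Rewrite chains generated by `work/s45/gen_s45.py` from the complete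
rewriting system of `work/s43/` (one relation per step, central letter re-sorted); the last two theorems by hand.
-/

namespace Summit.SmoothPoincare4.SmoothPoincare4.Theorems

variable {G : Type*} [Group G] {a b z : G}

set_option maxHeartbeats 1600000 in
/-- `b a⁻¹ = a⁻¹ b⁻¹ a` (from `a³ = (ba)² = z`): the letter `ba⁻¹` of the anchor `η = (b⁻²ab²)(ba⁻¹)³` is the `a`-conjugate of `b⁻¹`. -/
theorem SoloInformed_ba_ainv (r0 : a * a * a = z) (r1 : a * b * a * b = z) :
    b * a⁻¹
      = a⁻¹ * b⁻¹ * a := by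
  have hza : a * z = z * a := SoloInformed_anchor_za r0
  have hzb : b * z = z * b := SoloInformed_anchor_zb r0 r1
  have r3 : b * a * b * a = z := SoloInformed_anchor_baba r0 r1
  have cza := SoloInformed_zc_l hza; have czb := SoloInformed_zc_l hzb; have czA := SoloInformed_zc_il hza
  have czB := SoloInformed_zc_il hzb; have cZa := SoloInformed_zc_zl hza; have cZb := SoloInformed_zc_zl hzb
  have cZA := SoloInformed_zc_izl hza; have cZB := SoloInformed_zc_izl hzb; have tzA := SoloInformed_zc_i hza
  have tzB := SoloInformed_zc_i hzb; have tZa := SoloInformed_zc_z hza; have tZb := SoloInformed_zc_z hzb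
  have tZA := SoloInformed_zc_iz hza; have tZB := SoloInformed_zc_iz hzb
  have eL : b * a⁻¹
      = b * a⁻¹ := by
    simp only []
  have eR : a⁻¹ * b⁻¹ * a
      = a⁻¹ * b⁻¹ * a := by
    simp only [mul_assoc]
  rw [eL, eR]
  calc b * a⁻¹
    _ = z⁻¹ * b * a⁻¹ * z := by simp only [mul_assoc, czb, tzA, inv_mul_cancel_left]
    _ = z⁻¹ * b * a * a := by rw [← r0]; simp only [mul_assoc, mul_inv_rev, inv_mul_cancel_left]
    _ = z⁻¹ * b * a * a := by simp only [mul_assoc]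
    _ = a⁻¹ * b⁻¹ * a := by rw [← r3]; simp only [mul_assoc, mul_inv_rev, inv_mul_cancel, mul_one]

set_option maxHeartbeats 1600000 in
/-- door class `δ`: `g₄ = b³a⁻¹b⁻² = (b²a⁻¹)·b⁻¹·(b²a⁻¹)⁻¹` EXACTLY (no central correction) — `g₄` is a rebased `e₇`-loop (lift of the braid axis of `T(2,7)`). -/
theorem SoloInformed_g4_braidConj (r0 : a * a * a = z) (r1 : a * b * a * b = z) (r2 : b * b * b * b * b * b * b = z) :
    b * b * b * a⁻¹ * b⁻¹ * b⁻¹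
      = b * b * a⁻¹ * b⁻¹ * a * b⁻¹ * b⁻¹ := by
  have hza : a * z = z * a := SoloInformed_anchor_za r0
  have hzb : b * z = z * b := SoloInformed_anchor_zb r0 r1
  have r3 : b * a * b * a = z := SoloInformed_anchor_baba r0 r1
  have cza := SoloInformed_zc_l hza; have czb := SoloInformed_zc_l hzb; have czA := SoloInformed_zc_il hza
  have czB := SoloInformed_zc_il hzb; have cZa := SoloInformed_zc_zl hza; have cZb := SoloInformed_zc_zl hzb
  have cZA := SoloInformed_zc_izl hza; have cZB := SoloInformed_zc_izl hzb; have tzA := SoloInformed_zc_i hza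
  have tzB := SoloInformed_zc_i hzb; have tZa := SoloInformed_zc_z hza; have tZb := SoloInformed_zc_z hzb
  have tZA := SoloInformed_zc_iz hza; have tZB := SoloInformed_zc_iz hzb
  have eL : b * b * b * a⁻¹ * b⁻¹ * b⁻¹
      = b * b * b * a⁻¹ * b⁻¹ * b⁻¹ := by
    simp only [mul_assoc]
  have eR : b * b * a⁻¹ * b⁻¹ * a * b⁻¹ * b⁻¹
      = b * b * a⁻¹ * b⁻¹ * a * b⁻¹ * b⁻¹ := by
    simp only [mul_assoc]
  rw [eL, eR]
  calc b * b * b * a⁻¹ * b⁻¹ * b⁻¹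
    _ = b * b * b * z⁻¹ * b * a * b⁻¹ := by rw [← r3]; simp only [mul_assoc, mul_inv_rev, inv_mul_cancel, mul_one]
    _ = z⁻¹ * b * b * b * b * a * b⁻¹ := by simp only [mul_assoc, cZb, tZb]
    _ = z⁻¹ * b⁻¹ * b⁻¹ * b⁻¹ * z * a * b⁻¹ := by rw [← r2]; simp only [mul_assoc, mul_inv_rev, inv_mul_cancel_left, inv_mul_cancel, mul_one]
    _ = b⁻¹ * b⁻¹ * b⁻¹ * a * b⁻¹ := by simp only [mul_assoc, czB, tzB, inv_mul_cancel_left]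
    _ = z⁻¹ * b⁻¹ * b⁻¹ * b⁻¹ * z * a * b⁻¹ := by simp only [mul_assoc, czB, tzB, inv_mul_cancel_left]
    _ = z⁻¹ * b * b * b * b * a * b⁻¹ := by rw [← r2]; simp only [mul_assoc, mul_inv_rev, inv_mul_cancel_left, inv_mul_cancel, mul_one]
    _ = b * b * b * z⁻¹ * b * a * b⁻¹ := by simp only [mul_assoc, cZb, tZb]
    _ = b * b * b * a⁻¹ * b⁻¹ * b⁻¹ := by rw [← r3]; simp only [mul_assoc, mul_inv_rev, inv_mul_cancel, mul_one]
    _ = z⁻¹ * b * b * b * a⁻¹ * z * b⁻¹ * b⁻¹ := by simp only [mul_assoc, czb, tzA, inv_mul_cancel_left]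
    _ = z⁻¹ * b * b * b * a * a * b⁻¹ * b⁻¹ := by rw [← r0]; simp only [mul_assoc, mul_inv_rev, inv_mul_cancel_left]
    _ = b * b * z⁻¹ * b * a * a * b⁻¹ * b⁻¹ := by simp only [mul_assoc, cZb, tZb]
    _ = b * b * a⁻¹ * b⁻¹ * a * b⁻¹ * b⁻¹ := by rw [← r3]; simp only [mul_assoc, mul_inv_rev, inv_mul_cancel, mul_one]

set_option maxHeartbeats 1600000 in
/-- door (δ), first member: `b² η b⁻² = a · g₄³` — so `X(η) ≅ X(a·g₄³)`, the multiplicity-one log transform of `S⁴ = X(a)` along the page torus `T₇ = T_{g₄}` in direction `3λ`. -/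
theorem SoloInformed_doorDelta_conj (r0 : a * a * a = z) (r1 : a * b * a * b = z) :
    b * b * b⁻¹ * b⁻¹ * b⁻¹ * a * b⁻¹ * a * b⁻¹ * b⁻¹ * b⁻¹ * a * b⁻¹ * b⁻¹
      = a * b * b * b * a⁻¹ * b⁻¹ * b⁻¹ * b * b * b * a⁻¹ * b⁻¹ * b⁻¹ * b * b * b * a⁻¹ * b⁻¹ * b⁻¹ := by
  have hza : a * z = z * a := SoloInformed_anchor_za r0
  have hzb : b * z = z * b := SoloInformed_anchor_zb r0 r1
  have r3 : b * a * b * a = z := SoloInformed_anchor_baba r0 r1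
  have cza := SoloInformed_zc_l hza; have czb := SoloInformed_zc_l hzb; have czA := SoloInformed_zc_il hza
  have czB := SoloInformed_zc_il hzb; have cZa := SoloInformed_zc_zl hza; have cZb := SoloInformed_zc_zl hzb
  have cZA := SoloInformed_zc_izl hza; have cZB := SoloInformed_zc_izl hzb; have tzA := SoloInformed_zc_i hza
  have tzB := SoloInformed_zc_i hzb; have tZa := SoloInformed_zc_z hza; have tZb := SoloInformed_zc_z hzb
  have tZA := SoloInformed_zc_iz hza; have tZB := SoloInformed_zc_iz hzb
  have eL : b * b * b⁻¹ * b⁻¹ * b⁻¹ * a * b⁻¹ * a * b⁻¹ * b⁻¹ * b⁻¹ * a * b⁻¹ * b⁻¹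
      = b⁻¹ * a * b⁻¹ * a * b⁻¹ * b⁻¹ * b⁻¹ * a * b⁻¹ * b⁻¹ := by
    simp only [mul_assoc, mul_inv_cancel, mul_one, one_mul]
  have eR : a * b * b * b * a⁻¹ * b⁻¹ * b⁻¹ * b * b * b * a⁻¹ * b⁻¹ * b⁻¹ * b * b * b * a⁻¹ * b⁻¹ * b⁻¹
      = a * b * b * b * a⁻¹ * b * a⁻¹ * b * a⁻¹ * b⁻¹ * b⁻¹ := by
    simp only [mul_assoc, inv_mul_cancel, mul_one]
  rw [eL, eR]
  calc b⁻¹ * a * b⁻¹ * a * b⁻¹ * b⁻¹ * b⁻¹ * a * b⁻¹ * b⁻¹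
    _ = z * b⁻¹ * a * b⁻¹ * a * b⁻¹ * b⁻¹ * b⁻¹ * a * z⁻¹ * b⁻¹ * b⁻¹ := by simp only [mul_assoc, cZa, cZB, tZa, mul_inv_cancel_left]
    _ = z * b⁻¹ * a * b⁻¹ * a * b⁻¹ * b⁻¹ * b⁻¹ * a⁻¹ * a⁻¹ * b⁻¹ * b⁻¹ := by rw [← r0]; simp only [mul_assoc, mul_inv_rev, mul_inv_cancel_left]
    _ = z * b⁻¹ * a * b⁻¹ * a * b⁻¹ * b⁻¹ * b⁻¹ * a⁻¹ * a⁻¹ * b⁻¹ * b⁻¹ := by simp only [mul_assoc]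
    _ = a * b * a * a * b⁻¹ * a * b⁻¹ * b⁻¹ * b⁻¹ * a⁻¹ * a⁻¹ * b⁻¹ * b⁻¹ := by rw [← r1]; simp only [mul_assoc, mul_inv_cancel, mul_one]
    _ = a * b * a * a * b⁻¹ * a * b⁻¹ * b⁻¹ * b⁻¹ * a⁻¹ * z⁻¹ * b * a * b⁻¹ := by rw [← r3]; simp only [mul_assoc, mul_inv_rev, inv_mul_cancel, mul_one]
    _ = z⁻¹ * a * b * a * a * b⁻¹ * a * b⁻¹ * b⁻¹ * b⁻¹ * a⁻¹ * b * a * b⁻¹ := by simp only [mul_assoc, cZa, cZb, cZB, tZA]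
    _ = z⁻¹ * a * b * a * a * b⁻¹ * a * b⁻¹ * b⁻¹ * z⁻¹ * a * b * b * a * b⁻¹ := by rw [← r1]; simp only [mul_assoc, mul_inv_rev, inv_mul_cancel, mul_one]
    _ = z⁻¹ * z⁻¹ * a * b * a * a * b⁻¹ * a * b⁻¹ * b⁻¹ * a * b * b * a * b⁻¹ := by simp only [mul_assoc, cZa, cZb, cZB, tZB]
    _ = z⁻¹ * z⁻¹ * a * b * a⁻¹ * z * b⁻¹ * a * b⁻¹ * b⁻¹ * a * b * b * a * b⁻¹ := by rw [← r0]; simp only [mul_assoc, mul_inv_rev, inv_mul_cancel_left, inv_mul_cancel, mul_one]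
    _ = z⁻¹ * a * b * a⁻¹ * b⁻¹ * a * b⁻¹ * b⁻¹ * a * b * b * a * b⁻¹ := by simp only [mul_assoc, cza, czb, tzA, inv_mul_cancel_left]
    _ = a * b * a⁻¹ * b⁻¹ * a * z⁻¹ * b⁻¹ * b⁻¹ * a * b * b * a * b⁻¹ := by simp only [mul_assoc, cZa, cZA, cZb, cZB, tZa]
    _ = a * b * a⁻¹ * b⁻¹ * a⁻¹ * a⁻¹ * b⁻¹ * b⁻¹ * a * b * b * a * b⁻¹ := by rw [← r0]; simp only [mul_assoc, mul_inv_rev, mul_inv_cancel_left]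
    _ = a * b * a⁻¹ * b⁻¹ * a⁻¹ * z⁻¹ * b * a * b⁻¹ * a * b * b * a * b⁻¹ := by rw [← r3]; simp only [mul_assoc, mul_inv_rev, inv_mul_cancel, mul_one]
    _ = z⁻¹ * a * b * a⁻¹ * b⁻¹ * a⁻¹ * b * a * b⁻¹ * a * b * b * a * b⁻¹ := by simp only [mul_assoc, cZa, cZA, cZb, cZB, tZA]
    _ = z⁻¹ * a * b * b * z⁻¹ * b * a * b⁻¹ * a * b * b * a * b⁻¹ := by rw [← r1]; simp only [mul_assoc, mul_inv_rev, mul_inv_cancel_left, inv_mul_cancel, mul_one]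
    _ = z⁻¹ * z⁻¹ * a * b * b * b * a * b⁻¹ * a * b * b * a * b⁻¹ := by simp only [mul_assoc, cZa, cZb, tZb]
    _ = z⁻¹ * z⁻¹ * z⁻¹ * a * b * b * b * a * z * b⁻¹ * a * b * b * a * b⁻¹ := by simp only [mul_assoc, cza, czb, hza, inv_mul_cancel_left]
    _ = z⁻¹ * z⁻¹ * z⁻¹ * a * b * b * b * a * a * b * a * a * b * b * a * b⁻¹ := by rw [← r1]; simp only [mul_assoc, mul_inv_rev, mul_inv_cancel, inv_mul_cancel, mul_one]
    _ = z⁻¹ * z⁻¹ * z⁻¹ * a * b * b * b * a * a * b * a⁻¹ * z * b * b * a * b⁻¹ := by rw [← r0]; simp only [mul_assoc, mul_inv_rev, inv_mul_cancel_left, inv_mul_cancel, mul_one]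
    _ = z⁻¹ * z⁻¹ * a * b * b * b * a * a * b * a⁻¹ * b * b * a * b⁻¹ := by simp only [mul_assoc, cza, czb, tzA, inv_mul_cancel_left]
    _ = z⁻¹ * z⁻¹ * a * b * b * b * a⁻¹ * z * b * a⁻¹ * b * b * a * b⁻¹ := by rw [← r0]; simp only [mul_assoc, mul_inv_rev, inv_mul_cancel_left, inv_mul_cancel, mul_one]
    _ = z⁻¹ * a * b * b * b * a⁻¹ * b * a⁻¹ * b * b * a * b⁻¹ := by simp only [mul_assoc, cza, czb, tzA, inv_mul_cancel_left]
    _ = a * b * b * b * a⁻¹ * b * a⁻¹ * b * z⁻¹ * b * a * b⁻¹ := by simp only [mul_assoc, cZa, cZA, cZb, tZb]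
    _ = a * b * b * b * a⁻¹ * b * a⁻¹ * b * a⁻¹ * b⁻¹ * b⁻¹ := by rw [← r3]; simp only [mul_assoc, mul_inv_rev, inv_mul_cancel, mul_one]

/-- `g₄⁷ = z⁻¹` exactly: with `g₄ = (b²a⁻¹) b⁻¹ (b²a⁻¹)⁻¹` and `b⁷ = z` central.  Hence `X(a g₄^j z) = X(a g₄^{j-7})` and the
`T₇`-family is indexed by `j mod 14` in the mapping class group (where `z² = 1`). -/
theorem SoloInformed_g4_pow7 (r0 : a * a * a = z) (r1 : a * b * a * b = z) (r2 : b * b * b * b * b * b * b = z) :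
    (b * b * b * a⁻¹ * b⁻¹ * b⁻¹) ^ 7 = z⁻¹ := by
  have hza : a * z = z * a := SoloInformed_anchor_za r0
  have hzb : b * z = z * b := SoloInformed_anchor_zb r0 r1
  have cZb := SoloInformed_zc_zl hzb; have cZA := SoloInformed_zc_izl hza
  rw [SoloInformed_g4_braidConj r0 r1 r2]
  have e : (b * b * a⁻¹ * b⁻¹ * a * b⁻¹ * b⁻¹) ^ 7
      = b * b * a⁻¹ * (b * b * b * b * b * b * b)⁻¹ * a * b⁻¹ * b⁻¹ := by
    simp only [pow_succ, pow_zero, one_mul, mul_assoc, mul_inv_rev, inv_mul_cancel_left, mul_inv_cancel_left]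
  rw [e, r2]
  simp only [mul_assoc, cZb, cZA, inv_mul_cancel_left, mul_inv_cancel, mul_one]

/-- `x³` as a word (integer exponent). -/
theorem SoloInformed_zpow_three (x : G) : x ^ (3 : ℤ) = x * x * x := by
  rw [show (3 : ℤ) = ((3 : ℕ) : ℤ) from rfl, zpow_natCast]; simp only [pow_succ, pow_zero, one_mul, mul_assoc]

/-- `x⁻⁴ = x³ z` when `x⁷ = z⁻¹`. -/
theorem SoloInformed_zpow_negFour_of_pow7 (x c : G) (p7 : x ^ 7 = c⁻¹) : x ^ (-4 : ℤ) = x * x * x * c := by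
  have e : x ^ (-4 : ℤ) = x ^ (3 : ℤ) * (x ^ 7)⁻¹ := by group
  rw [e, p7, inv_inv, SoloInformed_zpow_three]

/-- DOOR D7 BOOKKEEPING.  Let `X : G → α` be conjugation invariant (the diffeomorphism type of the book `X(φ)` is such a
function on the mapping class group, `X(cφc⁻¹) ≅ X(φ)`).  If `X(a·g₄^j) = X(a)` for all `j : ℤ` — which ONE vanishing
(Gompf) disc for the page torus `T₇ = T_{g₄} ⊂ X(a) = S⁴` on the curve `λ_Seif + μ` provides, since the multiplicity-one
logarithmic transforms of `X(a)` along `T₇` in that direction with auxiliary multiplicity `j` are exactly the `X(a·g₄^j)` —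
then `X(η) = X(a)` (`j = 3`) and `X(z·η) = X(a)` (`j = -4`): both members of `{X(η), X(ηh)} = {𝔐₀, S⁴}` are `S⁴`. -/
theorem SoloInformed_fishtailDoor_bookkeeping (r0 : a * a * a = z) (r1 : a * b * a * b = z)
    (r2 : b * b * b * b * b * b * b = z) {α : Sort*} (X : G → α)
    (hconj : ∀ c g : G, X (c * g * c⁻¹) = X g)
    (hdoor : ∀ j : ℤ, X (a * (b * b * b * a⁻¹ * b⁻¹ * b⁻¹) ^ j) = X a) :
    X (b⁻¹ * b⁻¹ * b⁻¹ * a * b⁻¹ * a * b⁻¹ * b⁻¹ * b⁻¹ * a) = X a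
    ∧ X (z * (b⁻¹ * b⁻¹ * b⁻¹ * a * b⁻¹ * a * b⁻¹ * b⁻¹ * b⁻¹ * a)) = X a := by
  have hza : a * z = z * a := SoloInformed_anchor_za r0
  have hzb : b * z = z * b := SoloInformed_anchor_zb r0 r1
  have cza := SoloInformed_zc_l hza; have czb := SoloInformed_zc_l hzb; have czA := SoloInformed_zc_il hza
  have czB := SoloInformed_zc_il hzb; have tzA := SoloInformed_zc_i hza; have tzB := SoloInformed_zc_i hzb
  have d3 := SoloInformed_doorDelta_conj (z := z) r0 r1
  have p7 := SoloInformed_g4_pow7 r0 r1 r2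
  set g := b * b * b * a⁻¹ * b⁻¹ * b⁻¹ with hg
  set η := b⁻¹ * b⁻¹ * b⁻¹ * a * b⁻¹ * a * b⁻¹ * b⁻¹ * b⁻¹ * a with hη
  constructor
  · calc X η = X (b * b * η * (b * b)⁻¹) := (hconj (b * b) η).symm
      _ = X (a * g ^ (3 : ℤ)) := by
          congr 1
          rw [SoloInformed_zpow_three, hg, hη]
          simpa only [mul_assoc, mul_inv_rev] using d3
      _ = X a := hdoor 3
  · calc X (z * η) = X (b * b * (z * η) * (b * b)⁻¹) := (hconj (b * b) (z * η)).symm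
      _ = X (a * g ^ (-4 : ℤ)) := by
          congr 1
          rw [SoloInformed_zpow_negFour_of_pow7 g z p7, hg, hη]
          rw [show b * b * (z * (b⁻¹ * b⁻¹ * b⁻¹ * a * b⁻¹ * a * b⁻¹ * b⁻¹ * b⁻¹ * a)) * (b * b)⁻¹
              = z * (b * b * b⁻¹ * b⁻¹ * b⁻¹ * a * b⁻¹ * a * b⁻¹ * b⁻¹ * b⁻¹ * a * b⁻¹ * b⁻¹) by
                simp only [mul_assoc, mul_inv_rev, czb], d3]
          simp only [mul_assoc, cza, czA, czb, czB, tzB]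
      _ = X a := hdoor (-4)

end Summit.SmoothPoincare4.SmoothPoincare4.Theorems
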